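/-
# PROBE 27 (pub-hlocus ivhs-2, ENGINE B gen 57) — FROBENIUS EXACTNESS: THE MODULAR RANK DROP OF `×q^c` IS THE RANK OF `×q^{p−c}`

certified instances and evidence bearing on the general Hodge conjecture; no claim.

WHY THE UNIT COLUMN DROPS IN CHARACTERISTIC `p`.  In `A = K[x₁,…,x_k]/(xᵢ^{e+2})` the census operator is multiplication by `q = Σᵢ xᵢ^{e+1}`
(anchor 229's path-count matrix of `×q^c` is `c!` times a `0/1` matrix whose label blocks are the inclusion matrices `W_{t,t+c}(k − s)`, anchors
230/294), and `q^p = Σᵢ xᵢ^{p(e+1)} = 0` in characteristic `p`.  Hence `q^{p−c} · q^c = 0`: the image of `×q^c` lies in the kernel of `×q^{p−c}`,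
and in the block model this is Wilson's identity `W_{t,t+(p−c)} · W_{t+(p−c),t+p} = C(p, p−c) · W_{t,t+p} ≡ 0 (mod p)` (anchor InclusionRankFiltration
`incl_mul_incl`).  THIS SHEET PROVES THAT THE INCLUSION IS AN EQUALITY BELOW THE MIDDLE and identifies the drop:
  §1 (EX-W) `wilson_sum_add_wilson_sum_eq` — for a prime `p > c ≥ 1` and `2(t + p − c) + c ≤ m`, Wilson's `p`-rank sums (anchor InclusionRankLift
     `rank_incl_eq_sum`) satisfy `WS_p(m; t+p−c, +c) + WS_p(m; t, +(p−c)) = C(m, t+p−c)`: anchor 304's periodic form (FY) twice — the correction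
     sums of the two powers are the same binomial progression read with a shift of one period (pure arithmetic, `Finset.sum_range_succ'`).
  §2 over ANY field `K` of characteristic `p`, for the inclusion matrices `W_{a,b}(α) S U = [S ⊆ U]` with `2(t+p−c) + c ≤ #α`:
     (EX-rank) `rank W_{t+p−c, t+p} + rank W_{t, t+p−c} = C(#α, t+p−c)`, and
     (EX-ker)  `range (W_{t,t+p−c}).vecMulLinear = ker (W_{t+p−c,t+p}).vecMulLinear` — THE LEFT KERNEL OF `W_{T,T+c}` IN CHARACTERISTIC `p` IS
     EXACTLY THE ROW SPACE OF `W_{T−(p−c),T}` (`T = t + p − c`): every modular relation among the rows of `W_{T,T+c}` is a Frobenius relation.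
  §3 THE CENSUS (anchor 229's matrices VERBATIM; `K` of characteristic `p`, `K₀` of characteristic `0`, prime `p > c ≥ 1`, and the levels
     `j` (power `p − c`) and `J = j + (p−c)(e+1)` (power `c`) with (H1) `J + c ≤ k` and (H2) `2J + (e+1)c ≤ (e+1)k` — (H2) puts `J` at or
     below the centre `(e+1)(k−c)/2` of anchor 312 and is the binding one for `e = 0`; (H1) is the binding one for `e ≥ 1` (for `e = 1` they agree)):
     (EX) `rank_charP_add_rank_charP_eq_rank_charZero` — `rank_K(×q^c, J) + rank_K(×q^{p−c}, j) = rank_{K₀}(×q^c, J)`: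
     THE CHARACTERISTIC-`p` RANK DROP OF `×q^c` AT LEVEL `J` EQUALS THE CHARACTERISTIC-`p` RANK OF `×q^{p−c}` AT LEVEL `j` — the matrix of
     `×q^{p−c} : A_d → A_{d+(p−c)(e+1)}` composed after `×q^c : A_{d−c(e+1)} → A_d` (`d = k(e+1) − J`; the rows of the first census matrix are
     the columns of the second).  Since `rank_{K₀}(×q^c, J) = dim A_d` there (THEOREM L, anchor 229: every block is below its middle, where
     `W_{t,t+c}` has full row rank in characteristic `0`, anchor `…InclusionPowers`), (EX) says: IN CHARACTERISTIC `p` THE SEQUENCE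
     `A_{d−c(e+1)} →(q^c) A_d →(q^{p−c}) A_{d+(p−c)(e+1)}` IS EXACT AT `A_d`, `d = k(e+1) − J`, for every level `J ≥ (p−c)(e+1)` allowed by (H1)/(H2)
     (for `J < (p−c)(e+1)` exactness at `A_d` is the surjectivity of `×q^c` onto `A_d`, anchors 326/330: no drop below the window).
     (EX′) the signed form `rank_{K₀} − rank_K = rank_K(×q^{p−c}, j)`; (EX-period) two steps: `rank_K(×q^c, j₀ + p(e+1)) + rank_{K₀}(×q^{p−c}, j₀ + c(e+1))
     = rank_{K₀}(×q^c, j₀ + p(e+1)) + rank_K(×q^c, j₀)` — the modular rank is the characteristic-`0` rank (THEOREM L, anchor 229) corrected by an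
     alternating sum down the ladder `J, J − (p−c)(e+1), J − p(e+1), …`, the census form of (FY).
  Per label (§3 (EX-summand)) this is (EX-W) for the labels feasible at `j`, and `WS_p = WS_0 = C(m,t)` (no correction, `t + c < p`) for the
  labels feasible at `J` only; (H1)/(H2) with anchor 320's label bounds put every block below its middle.
In this range anchors 326/330 (where the drop is non-zero) and PROBE 26 (the drop is non-decreasing along `J ↦ J + (e+1)`) become statements
about the rank of `×q^{p−c}`.
Own numerics FIRST (`probe27/exact_numerics.py`, `probe27/kit27.py` = job j279920): (EX-rank)/(EX-ker) on ACTUAL ranks, products and left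
kernels of `W_{t,n}(Fin m)` over GF(2,3,5,7), m ≤ 8: 180 + 35 instances, 0 violations; the block identity `CORR_P − CORR_0 = WS_p(T+c−p, T)`
behind (EX-W) for p ≤ 13, c < p, 2T + c ≤ m ≤ 300: 772 953 instances, 0 violations; (EX) on anchor 304's closed forms under (H1)∧(H2) for
p ∈ {2,3,5,7}, c < p, e ≤ 6, k ≤ 30/24/20/18: 6 348 instances, 0 violations — and the hypotheses bind: with (H2) relaxed by one (e = 0) all
97 instances fail (first `p = 2, c = 1, k = 2, J = 1`: drop 0, rank 1), with (H1) dropped (e ≥ 2, (H2) kept) 9 759 of 13 154 fail (first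
`p = 2, c = 1, e = 2, k = 5, J = 6`: drop 24, rank 34); (EX) on ACTUAL ranks of the census `0/1` matrices over ℚ and GF(p), k ≤ 5, e ≤ 2:
21 instances, 0 violations, each also matching THEOREM L and anchor 304.
LITERATURE (context, nothing imported or minted): §2 is — in the tree's matrix language and dualised — the `p`-EXACTNESS OF THE BOOLEAN
INCLUSION SEQUENCE of V. B. Mnukhin & J. Siemons, J. Combin. Theory Ser. A 74 (1996) 287–300, doi:10.1006/jcta.1996.0051: Theorem 3.6 and
Lemma 5.2 («balance condition»: `M_k →∂^{k−j} M_j →∂^{p−(k−j)} M_{j−p+(k−j)}` is exact at `M_j` whenever `j + k ≤ n`, here `j = T`, `k = T + c`),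
with their remark that `p`-exactness writes the `p`-rank of `∂^i` as an alternating sum of dimensions (= (EX-period)); it is re-proved below in a
few lines from Wilson's rank formula (anchor InclusionRankLift).  The transfer §3 to `×q^c` on the truncated polynomial ring (the census) is this
sheet's; past the middle the Boolean sequence is NOT `p`-exact (Mnukhin–Siemons §5, Betti numbers), which is why (H1)/(H2) bind.
EVIDENCE CLASS: kernel theorems about the census matrices; no census number changes; nothing here asserts anything about the Hodge conjecture.

Import: anchor 320 `…Theorems.HodgeLocusCensusUnitColumnRankDropBandProfile` (hence 304 (FY)/(W0), 294 (LW-p), 293, InclusionRankLift/Filtration).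
-/
import Summits.HodgeConjecture.HodgeConjecture.Theorems.HodgeLocusCensusUnitColumnRankDropBandProfile

set_option linter.dupNamespace false
set_option autoImplicit false

namespace Summit.HodgeConjecture.HodgeConjecture.HodgeLocus.Census.UnitColumnRankDropExact

open Module
open Summit.HodgeConjecture.HodgeConjecture.HodgeLocus.Census.ModelNonJumpC1All (colR)
open Summit.HodgeConjecture.HodgeConjecture.HodgeLocus.Census.UnitColumnRankDrop (wilson_sum_add_eq wilson_sum_zero_eq)
open Summit.HodgeConjecture.HodgeConjecture.HodgeLocus.Census.UnitColumnRankLevelsWilson (rank_mulDeltaPow_levels_eq_sum_wilson)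
open Summit.HodgeConjecture.HodgeConjecture.HodgeLocus.Census.InclusionRankComplement (cast_factorial_ne_zero)

/-! ## §1 (EX-W): the Wilson sums of the powers `c` and `p − c` one period apart add up to a binomial coefficient -/

/-- **(EX-W)** for a prime `p > c ≥ 1` and `2(t + p − c) + c ≤ m`:
`Σ_{i ≤ t+p−c} [p ∤ C(t+p−i, t+p−c−i)] (C(m,i) − C(m,i−1)) + Σ_{i ≤ t} [p ∤ C(t+p−c−i, t−i)] (C(m,i) − C(m,i−1)) = C(m, t+p−c)`, i.e.
`rank_p W_{t+p−c,t+p}(m) + rank_p W_{t,t+p−c}(m) = C(m, t+p−c)` in Wilson's closed form.  From anchor 304's (FY) for `(t+p−c, c)` and for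
`(t, p−c)`: the correction sum `Σ_b C(m, t+p−c−bp)` is common, and `Σ_{b ≥ 1} C(m, t+p−bp) = C(m,t) + Σ_{b ≥ 1} C(m, t−bp)`. -/
theorem wilson_sum_add_wilson_sum_eq {p c : ℕ} (hp : p.Prime) (hc : 0 < c) (hcp : c < p) (m t : ℕ) (hT : 2 * (t + (p - c)) + c ≤ m) :
    (∑ i ∈ Finset.range (t + (p - c) + 1),
        if p ∣ (t + (p - c) + c - i).choose (t + (p - c) - i) then 0 else (m.choose i - if i = 0 then 0 else m.choose (i - 1))) +
      ∑ i ∈ Finset.range (t + 1),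
        (if p ∣ (t + (p - c) - i).choose (t - i) then 0 else (m.choose i - if i = 0 then 0 else m.choose (i - 1))) =
    m.choose (t + (p - c)) := by
  have h1 := wilson_sum_add_eq hp hcp m (t + (p - c)) (t + (p - c) + c) rfl (by omega)
  have h2 := wilson_sum_add_eq hp (show p - c < p by omega) m t (t + (p - c)) rfl (by omega)
  have key : ∑ b ∈ Finset.range ((t + (p - c) + c) / p), m.choose (t + (p - c) + c - (b + 1) * p) =
      (∑ b ∈ Finset.range (t / p), m.choose (t - (b + 1) * p)) + m.choose t := by
    rw [show t + (p - c) + c = t + p by omega, Nat.add_div_right t hp.pos, Finset.sum_range_succ', Nat.zero_add, one_mul,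
      Nat.add_sub_cancel]
    congr 1
    refine Finset.sum_congr rfl (fun b _ => ?_)
    rw [show (b + 1 + 1) * p = (b + 1) * p + p by ring, Nat.add_sub_add_right]
  omega

/-! ## §2 (EX-rank), (EX-ker): in characteristic `p` the left kernel of `W_{T,T+c}` is the row space of `W_{T−(p−c),T}` -/

variable (K : Type*) [Field K] {α : Type*} [Fintype α] [DecidableEq α]

/-- **(EX-rank)** over a field of prime characteristic `p > c ≥ 1`, for `2(t+p−c) + c ≤ #α`:
`rank W_{t+p−c,t+p}(α) + rank W_{t,t+p−c}(α) = C(#α, t+p−c)` (Wilson's theorem, anchor InclusionRankLift, and (EX-W)). -/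
theorem rank_incl_add_rank_incl_eq (p : ℕ) [CharP K p] (hp : p.Prime) {c : ℕ} (hc : 0 < c) (hcp : c < p) (t : ℕ)
    (hT : 2 * (t + (p - c)) + c ≤ Fintype.card α) :
    (Matrix.of fun (S : {S : Finset α // S.card = t + (p - c)}) (U : {S : Finset α // S.card = t + (p - c) + c}) => if S.1 ⊆ U.1 then (1 : K) else 0).rank +
      (Matrix.of fun (S : {S : Finset α // S.card = t}) (U : {S : Finset α // S.card = t + (p - c)}) => if S.1 ⊆ U.1 then (1 : K) else 0).rank =
    (Fintype.card α).choose (t + (p - c)) := by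
  rw [InclusionRankLift.rank_incl_eq_sum K p (t + (p - c)) (t + (p - c) + c) (Nat.le_add_right _ _) (by omega),
    InclusionRankLift.rank_incl_eq_sum K p t (t + (p - c)) (Nat.le_add_right _ _) (by omega)]
  exact wilson_sum_add_wilson_sum_eq hp hc hcp (Fintype.card α) t hT

/-- **(EX-ker) FROBENIUS EXACTNESS FOR INCLUSION MATRICES.** Over a field of prime characteristic `p > c ≥ 1`, for `2(t+p−c) + c ≤ #α`:
`range (W_{t,t+p−c}).vecMulLinear = ker (W_{t+p−c,t+p}).vecMulLinear` — the left kernel of `W_{T,T+c}` (`T = t+p−c`, below the middle: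
`2T + c ≤ #α`) consists EXACTLY of the combinations of the rows of `W_{T−(p−c),T}`.  `⊆`: `y · W_{t,T} · W_{T,T+c} = C(p, p−c) · y · W_{t,T+c} = 0`
(anchor InclusionRankFiltration `incl_mul_incl`; `p ∣ C(p, p−c)`); `=`: dimensions, by (EX-rank) and rank–nullity.  In characteristic `0` the
left kernel is `0` there (full row rank).  This is the balance condition `j + k ≤ n` of Mnukhin–Siemons (JCTA 74 (1996), Lemma 5.2 / Thm 3.6),
dualised; census dictionary: the image of `×q^c` into a degree `A_d` below the middle is the kernel of `×q^{p−c}`. -/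
theorem range_vecMulLinear_eq_ker (p : ℕ) [CharP K p] (hp : p.Prime) {c : ℕ} (hc : 0 < c) (hcp : c < p) (t : ℕ)
    (hT : 2 * (t + (p - c)) + c ≤ Fintype.card α) :
    LinearMap.range (Matrix.vecMulLinear
      (Matrix.of fun (S : {S : Finset α // S.card = t}) (U : {S : Finset α // S.card = t + (p - c)}) => if S.1 ⊆ U.1 then (1 : K) else 0)) =
    LinearMap.ker (Matrix.vecMulLinear
      (Matrix.of fun (S : {S : Finset α // S.card = t + (p - c)}) (U : {S : Finset α // S.card = t + (p - c) + c}) => if S.1 ⊆ U.1 then (1 : K) else 0)) := by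
  refine Submodule.eq_of_le_of_finrank_eq ?_ ?_
  · rintro _ ⟨y, rfl⟩
    rw [LinearMap.mem_ker, Matrix.vecMulLinear_apply, Matrix.vecMulLinear_apply, Matrix.vecMul_vecMul,
      InclusionRankFiltration.incl_mul_incl K t (t + (p - c)) (t + (p - c) + c) (Nat.le_add_right _ _),
      show t + (p - c) + c - t = p by omega, Nat.add_sub_cancel_left,
      (CharP.cast_eq_zero_iff K p _).mpr (hp.dvd_choose_self (by omega) (by omega)), zero_smul, Matrix.vecMul_zero]
  · have hA : ∀ (a b : ℕ) (A : Matrix {S : Finset α // S.card = a} {S : Finset α // S.card = b} K),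
        finrank K (LinearMap.range (Matrix.vecMulLinear A)) = A.rank := fun a b A => by
      rw [← Matrix.mulVecLin_transpose, ← Matrix.rank_transpose]
      rfl
    have h1 := LinearMap.finrank_range_add_finrank_ker (Matrix.vecMulLinear
      (Matrix.of fun (S : {S : Finset α // S.card = t + (p - c)}) (U : {S : Finset α // S.card = t + (p - c) + c}) => if S.1 ⊆ U.1 then (1 : K) else 0))
    rw [finrank_fintype_fun_eq_card, Fintype.card_finset_len, hA] at h1
    rw [hA]
    have h2 := rank_incl_add_rank_incl_eq K p hp hc hcp t hT
    omega

/-! ## §3 THE CENSUS: the drop of `×q^c` at level `J = j + (p−c)(e+1)` is the rank of `×q^{p−c}` at level `j` -/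

/-- (EX-summand) anchor 294's label summands: for a prime `p > c ≥ 1`, (H1) `J + c ≤ k`, (H2) `2J + (e+1)c ≤ (e+1)k` (`J = j + (p−c)(e+1)`) and
every label `μ`: `WS_p(μ; ×q^c, J) + WS_p(μ; ×q^{p−c}, j) = WS_0(μ; ×q^c, J)`.  A label feasible at `J` has its block `W_{t,t+c}(k − s)` below
the middle ((H1)/(H2), anchor 320's `s ≤ Σμ ≤ e·s`), so `WS_0 = C(k−s, t)` ((W0) of anchor 304); if it is feasible at `j` too then its
`×q^{p−c}`-block is `W_{t−(p−c),t}(k − s)` and (EX-W) applies; if not, `t + c < p` and `WS_p = C(k−s,t)` by (FY) with empty corrections. -/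
theorem blockval_add_blockval_eq (p k e c j : ℕ) (μ : Fin k → Fin (e + 1)) (hp : p.Prime) (hc : 0 < c) (hcp : c < p)
    (h1 : j + (p - c) * (e + 1) + c ≤ k) (h2 : 2 * (j + (p - c) * (e + 1)) + (e + 1) * c ≤ (e + 1) * k) :
    (if (e + 1) ∣ (j + (p - c) * (e + 1) + ∑ i, (μ i : ℕ)) ∧ (e + 1) * (Finset.univ.filter (fun l => (μ l : ℕ) ≠ 0)).card ≤ j + (p - c) * (e + 1) + ∑ i, (μ i : ℕ) then
          (if k - (Finset.univ.filter (fun l => (μ l : ℕ) ≠ 0)).card <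
              ((j + (p - c) * (e + 1) + ∑ i, (μ i : ℕ)) / (e + 1) - (Finset.univ.filter (fun l => (μ l : ℕ) ≠ 0)).card) + c then 0
           else if ((j + (p - c) * (e + 1) + ∑ i, (μ i : ℕ)) / (e + 1) - (Finset.univ.filter (fun l => (μ l : ℕ) ≠ 0)).card) +
              (((j + (p - c) * (e + 1) + ∑ i, (μ i : ℕ)) / (e + 1) - (Finset.univ.filter (fun l => (μ l : ℕ) ≠ 0)).card) + c) ≤
              k - (Finset.univ.filter (fun l => (μ l : ℕ) ≠ 0)).card then
             ∑ i ∈ Finset.range (((j + (p - c) * (e + 1) + ∑ i, (μ i : ℕ)) / (e + 1) - (Finset.univ.filter (fun l => (μ l : ℕ) ≠ 0)).card) + 1),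
               if p ∣ (((j + (p - c) * (e + 1) + ∑ i, (μ i : ℕ)) / (e + 1) - (Finset.univ.filter (fun l => (μ l : ℕ) ≠ 0)).card) + c - i).choose
                   (((j + (p - c) * (e + 1) + ∑ i, (μ i : ℕ)) / (e + 1) - (Finset.univ.filter (fun l => (μ l : ℕ) ≠ 0)).card) - i) then 0
               else ((k - (Finset.univ.filter (fun l => (μ l : ℕ) ≠ 0)).card).choose i -
                 if i = 0 then 0 else (k - (Finset.univ.filter (fun l => (μ l : ℕ) ≠ 0)).card).choose (i - 1))
           else
             ∑ i ∈ Finset.range (k - (Finset.univ.filter (fun l => (μ l : ℕ) ≠ 0)).card -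
                 ((((j + (p - c) * (e + 1) + ∑ i, (μ i : ℕ)) / (e + 1) - (Finset.univ.filter (fun l => (μ l : ℕ) ≠ 0)).card)) + c) + 1),
               if p ∣ (k - (Finset.univ.filter (fun l => (μ l : ℕ) ≠ 0)).card -
                   (((j + (p - c) * (e + 1) + ∑ i, (μ i : ℕ)) / (e + 1) - (Finset.univ.filter (fun l => (μ l : ℕ) ≠ 0)).card)) - i).choose
                   (k - (Finset.univ.filter (fun l => (μ l : ℕ) ≠ 0)).card -
                     ((((j + (p - c) * (e + 1) + ∑ i, (μ i : ℕ)) / (e + 1) - (Finset.univ.filter (fun l => (μ l : ℕ) ≠ 0)).card)) + c) - i) then 0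
               else ((k - (Finset.univ.filter (fun l => (μ l : ℕ) ≠ 0)).card).choose i -
                 if i = 0 then 0 else (k - (Finset.univ.filter (fun l => (μ l : ℕ) ≠ 0)).card).choose (i - 1)))
        else 0) +
      (if (e + 1) ∣ (j + ∑ i, (μ i : ℕ)) ∧ (e + 1) * (Finset.univ.filter (fun l => (μ l : ℕ) ≠ 0)).card ≤ j + ∑ i, (μ i : ℕ) then
          (if k - (Finset.univ.filter (fun l => (μ l : ℕ) ≠ 0)).card <
              ((j + ∑ i, (μ i : ℕ)) / (e + 1) - (Finset.univ.filter (fun l => (μ l : ℕ) ≠ 0)).card) + (p - c) then 0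
           else if ((j + ∑ i, (μ i : ℕ)) / (e + 1) - (Finset.univ.filter (fun l => (μ l : ℕ) ≠ 0)).card) +
              (((j + ∑ i, (μ i : ℕ)) / (e + 1) - (Finset.univ.filter (fun l => (μ l : ℕ) ≠ 0)).card) + (p - c)) ≤
              k - (Finset.univ.filter (fun l => (μ l : ℕ) ≠ 0)).card then
             ∑ i ∈ Finset.range (((j + ∑ i, (μ i : ℕ)) / (e + 1) - (Finset.univ.filter (fun l => (μ l : ℕ) ≠ 0)).card) + 1),
               if p ∣ (((j + ∑ i, (μ i : ℕ)) / (e + 1) - (Finset.univ.filter (fun l => (μ l : ℕ) ≠ 0)).card) + (p - c) - i).choose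
                   (((j + ∑ i, (μ i : ℕ)) / (e + 1) - (Finset.univ.filter (fun l => (μ l : ℕ) ≠ 0)).card) - i) then 0
               else ((k - (Finset.univ.filter (fun l => (μ l : ℕ) ≠ 0)).card).choose i -
                 if i = 0 then 0 else (k - (Finset.univ.filter (fun l => (μ l : ℕ) ≠ 0)).card).choose (i - 1))
           else
             ∑ i ∈ Finset.range (k - (Finset.univ.filter (fun l => (μ l : ℕ) ≠ 0)).card -
                 ((((j + ∑ i, (μ i : ℕ)) / (e + 1) - (Finset.univ.filter (fun l => (μ l : ℕ) ≠ 0)).card)) + (p - c)) + 1),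
               if p ∣ (k - (Finset.univ.filter (fun l => (μ l : ℕ) ≠ 0)).card -
                   (((j + ∑ i, (μ i : ℕ)) / (e + 1) - (Finset.univ.filter (fun l => (μ l : ℕ) ≠ 0)).card)) - i).choose
                   (k - (Finset.univ.filter (fun l => (μ l : ℕ) ≠ 0)).card -
                     ((((j + ∑ i, (μ i : ℕ)) / (e + 1) - (Finset.univ.filter (fun l => (μ l : ℕ) ≠ 0)).card)) + (p - c)) - i) then 0
               else ((k - (Finset.univ.filter (fun l => (μ l : ℕ) ≠ 0)).card).choose i -
                 if i = 0 then 0 else (k - (Finset.univ.filter (fun l => (μ l : ℕ) ≠ 0)).card).choose (i - 1)))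
        else 0) =
    (if (e + 1) ∣ (j + (p - c) * (e + 1) + ∑ i, (μ i : ℕ)) ∧ (e + 1) * (Finset.univ.filter (fun l => (μ l : ℕ) ≠ 0)).card ≤ j + (p - c) * (e + 1) + ∑ i, (μ i : ℕ) then
          (if k - (Finset.univ.filter (fun l => (μ l : ℕ) ≠ 0)).card <
              ((j + (p - c) * (e + 1) + ∑ i, (μ i : ℕ)) / (e + 1) - (Finset.univ.filter (fun l => (μ l : ℕ) ≠ 0)).card) + c then 0
           else if ((j + (p - c) * (e + 1) + ∑ i, (μ i : ℕ)) / (e + 1) - (Finset.univ.filter (fun l => (μ l : ℕ) ≠ 0)).card) +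
              (((j + (p - c) * (e + 1) + ∑ i, (μ i : ℕ)) / (e + 1) - (Finset.univ.filter (fun l => (μ l : ℕ) ≠ 0)).card) + c) ≤
              k - (Finset.univ.filter (fun l => (μ l : ℕ) ≠ 0)).card then
             ∑ i ∈ Finset.range (((j + (p - c) * (e + 1) + ∑ i, (μ i : ℕ)) / (e + 1) - (Finset.univ.filter (fun l => (μ l : ℕ) ≠ 0)).card) + 1),
               if 0 ∣ (((j + (p - c) * (e + 1) + ∑ i, (μ i : ℕ)) / (e + 1) - (Finset.univ.filter (fun l => (μ l : ℕ) ≠ 0)).card) + c - i).choose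
                   (((j + (p - c) * (e + 1) + ∑ i, (μ i : ℕ)) / (e + 1) - (Finset.univ.filter (fun l => (μ l : ℕ) ≠ 0)).card) - i) then 0
               else ((k - (Finset.univ.filter (fun l => (μ l : ℕ) ≠ 0)).card).choose i -
                 if i = 0 then 0 else (k - (Finset.univ.filter (fun l => (μ l : ℕ) ≠ 0)).card).choose (i - 1))
           else
             ∑ i ∈ Finset.range (k - (Finset.univ.filter (fun l => (μ l : ℕ) ≠ 0)).card -
                 ((((j + (p - c) * (e + 1) + ∑ i, (μ i : ℕ)) / (e + 1) - (Finset.univ.filter (fun l => (μ l : ℕ) ≠ 0)).card)) + c) + 1),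
               if 0 ∣ (k - (Finset.univ.filter (fun l => (μ l : ℕ) ≠ 0)).card -
                   (((j + (p - c) * (e + 1) + ∑ i, (μ i : ℕ)) / (e + 1) - (Finset.univ.filter (fun l => (μ l : ℕ) ≠ 0)).card)) - i).choose
                   (k - (Finset.univ.filter (fun l => (μ l : ℕ) ≠ 0)).card -
                     ((((j + (p - c) * (e + 1) + ∑ i, (μ i : ℕ)) / (e + 1) - (Finset.univ.filter (fun l => (μ l : ℕ) ≠ 0)).card)) + c) - i) then 0
               else ((k - (Finset.univ.filter (fun l => (μ l : ℕ) ≠ 0)).card).choose i -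
                 if i = 0 then 0 else (k - (Finset.univ.filter (fun l => (μ l : ℕ) ≠ 0)).card).choose (i - 1)))
        else 0) := by
  have hUB := UnitColumnRankDropBandProfile.sum_label_le_mul_card_filter k e μ
  have hLB := UnitColumnRankDropBandProfile.card_filter_le_sum_label k e μ
  by_cases hF : (e + 1) ∣ (j + (p - c) * (e + 1) + ∑ i, (μ i : ℕ)) ∧ (e + 1) * (Finset.univ.filter (fun l => (μ l : ℕ) ≠ 0)).card ≤ j + (p - c) * (e + 1) + ∑ i, (μ i : ℕ)
  swap
  · have hF' : ¬ ((e + 1) ∣ (j + ∑ i, (μ i : ℕ)) ∧ (e + 1) * (Finset.univ.filter (fun l => (μ l : ℕ) ≠ 0)).card ≤ j + ∑ i, (μ i : ℕ)) := fun h => hF ⟨by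
      rw [show j + (p - c) * (e + 1) + ∑ i, (μ i : ℕ) = (j + ∑ i, (μ i : ℕ)) + (e + 1) * (p - c) by ring]
      exact dvd_add h.1 (dvd_mul_right _ _), le_trans h.2 (by omega)⟩
    rw [if_neg hF, if_neg hF, if_neg hF', add_zero]
  · rw [if_pos hF, if_pos hF]
    generalize hS : (Finset.univ.filter (fun l => (μ l : ℕ) ≠ 0)).card = S at *
    generalize hσ : (∑ i, (μ i : ℕ)) = σ at *
    obtain ⟨q, hq⟩ := hF.1
    have hq1 : (j + (p - c) * (e + 1) + σ) / (e + 1) = q := by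
      rw [hq, Nat.mul_div_cancel_left _ (Nat.succ_pos e)]
    rw [hq1]
    have hl0 : (e + 1) * (p - c) = (p - c) * (e + 1) := Nat.mul_comm _ _
    have hSq : S ≤ q := Nat.le_of_mul_le_mul_left (by rw [← hq]; exact hF.2) (Nat.succ_pos e)
    have hpq : p - c ≤ q := by
      have h : (e + 1) * (p - c) ≤ (e + 1) * q := by rw [← hq]; omega
      exact Nat.le_of_mul_le_mul_left h (Nat.succ_pos e)
    have key : 2 * (q - S) + c ≤ k - S := by
      rcases Nat.eq_zero_or_pos e with he | he
      · subst he
        rw [Nat.zero_mul] at hUB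
        omega
      · have hl1 : (e + 1) * S = e * S + S := by ring
        have hl2 : (e + 1) * q = e * q + q := by ring
        have hl3 : (e - 1) * S = e * S - S := Nat.sub_one_mul e S
        have hl4 : (e - 1) * (j + (p - c) * (e + 1)) = e * (j + (p - c) * (e + 1)) - (j + (p - c) * (e + 1)) := Nat.sub_one_mul e _
        have hS1 : S ≤ e * S := Nat.le_mul_of_pos_left S he
        have hj1 : j + (p - c) * (e + 1) ≤ e * (j + (p - c) * (e + 1)) := Nat.le_mul_of_pos_left _ he
        have hF2 := hF.2
        have hSj : S ≤ j + (p - c) * (e + 1) := by omega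
        have hprod : (e - 1) * S ≤ (e - 1) * (j + (p - c) * (e + 1)) := Nat.mul_le_mul_left _ hSj
        have hA : (e + 1) * (2 * q) ≤ (e + 1) * (j + (p - c) * (e + 1) + S) := by
          have hl5 : (e + 1) * (2 * q) = 2 * (e * q) + 2 * q := by ring
          have hl6 : (e + 1) * (j + (p - c) * (e + 1) + S) = e * (j + (p - c) * (e + 1)) + e * S + (j + (p - c) * (e + 1)) + S := by ring
          omega
        have hB : 2 * q ≤ j + (p - c) * (e + 1) + S := Nat.le_of_mul_le_mul_left hA (Nat.succ_pos e)
        omega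
    rw [if_neg (show ¬ (k - S < q - S + c) by omega), if_neg (show ¬ (k - S < q - S + c) by omega),
      if_pos (show q - S + (q - S + c) ≤ k - S by omega), if_pos (show q - S + (q - S + c) ≤ k - S by omega),
      wilson_sum_zero_eq c (k - S) (q - S) (q - S + c) rfl (by omega)]
    by_cases hF' : (e + 1) ∣ (j + σ) ∧ (e + 1) * S ≤ j + σ
    · rw [if_pos hF']
      obtain ⟨q', hq'⟩ := hF'.1
      have hqq : q = q' + (p - c) := by
        refine Nat.eq_of_mul_eq_mul_left (Nat.succ_pos e) ?_
        rw [← hq, show (e + 1) * (q' + (p - c)) = (e + 1) * q' + (p - c) * (e + 1) by ring, ← hq']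
        ring
      subst hqq
      have hq2 : (j + σ) / (e + 1) = q' := by
        rw [hq', Nat.mul_div_cancel_left _ (Nat.succ_pos e)]
      rw [hq2]
      have hSq' : S ≤ q' := Nat.le_of_mul_le_mul_left (by rw [← hq']; exact hF'.2) (Nat.succ_pos e)
      rw [if_neg (show ¬ (k - S < q' - S + (p - c)) by omega), if_pos (show q' - S + (q' - S + (p - c)) ≤ k - S by omega),
        show q' + (p - c) - S = q' - S + (p - c) by omega]
      exact wilson_sum_add_wilson_sum_eq hp hc hcp (k - S) (q' - S) (by omega)
    · rw [if_neg hF', add_zero]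
      have hdiv : (e + 1) ∣ (j + σ) := by
        refine (Nat.dvd_add_right (dvd_mul_right (e + 1) (p - c))).mp ?_
        rw [show (e + 1) * (p - c) + (j + σ) = j + (p - c) * (e + 1) + σ by ring]
        exact hF.1
      have hlt : q < S + (p - c) := by
        have hF2 : ¬ ((e + 1) * S ≤ j + σ) := fun h => hF' ⟨hdiv, h⟩
        have h : (e + 1) * q < (e + 1) * (S + (p - c)) := by
          rw [← hq, show (e + 1) * (S + (p - c)) = (e + 1) * S + (p - c) * (e + 1) by ring]
          omega
        exact Nat.lt_of_mul_lt_mul_left h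
      have h3 := wilson_sum_add_eq hp hcp (k - S) (q - S) (q - S + c) rfl (by omega)
      rw [Nat.div_eq_of_lt (show q - S + c < p by omega), Nat.div_eq_of_lt (show q - S < p by omega), Finset.sum_range_zero,
        Finset.sum_range_zero, add_zero, add_zero] at h3
      exact h3

/-- **(EX) FROBENIUS EXACTNESS: THE MODULAR RANK DROP OF `×q^c` IS THE RANK OF `×q^{p−c}`.** For a field `K` of prime characteristic `p`, a
field `K₀` of characteristic `0`, `1 ≤ c < p`, and levels `j`, `J = j + (p−c)(e+1)` with (H1) `J + c ≤ k`, (H2) `2J + (e+1)c ≤ (e+1)k`: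
`rank_K(×q^c at J) + rank_K(×q^{p−c} at j) = rank_{K₀}(×q^c at J)` — anchor 229's multiplicity matrices of `×q^c` on `K[x₁,…,x_k]/(xᵢ^{e+2})`
VERBATIM (the rows of the `×q^c` matrix are the columns of the `×q^{p−c}` matrix: degree `k(e+1) − J`).  Anchor 294's (LW-p) three times and
(EX-summand) over the labels.  `q^p = Σᵢ xᵢ^{p(e+1)} = 0` in characteristic `p`; this says the complex `×q^c`, `×q^{p−c}` is exact there. -/
theorem rank_charP_add_rank_charP_eq_rank_charZero (K K₀ : Type*) [Field K] [Field K₀] (p : ℕ) [CharP K p] [CharZero K₀] (hp : p.Prime)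
    (k e c j : ℕ) (hc : 0 < c) (hcp : c < p) (h1 : j + (p - c) * (e + 1) + c ≤ k)
    (h2 : 2 * (j + (p - c) * (e + 1)) + (e + 1) * c ≤ (e + 1) * k) :
    (Matrix.of fun (v : {v : Fin k → Fin (e + 2) // (∑ i, (v i : ℕ)) + (j + (p - c) * (e + 1)) = k * (e + 1)})
        (m : {m : Fin k → Fin (e + 2) // (∑ i, (m i : ℕ)) + ((j + (p - c) * (e + 1)) + c * (e + 1)) = k * (e + 1)}) =>
      ((((List.flatMap (colR (e + 3)))^[c] [List.ofFn (fun i => (m.1 i : ℕ))]).count (List.ofFn (fun i => (v.1 i : ℕ))) : ℕ) : K)).rank +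
    (Matrix.of fun (v : {v : Fin k → Fin (e + 2) // (∑ i, (v i : ℕ)) + j = k * (e + 1)})
        (m : {m : Fin k → Fin (e + 2) // (∑ i, (m i : ℕ)) + (j + (p - c) * (e + 1)) = k * (e + 1)}) =>
      ((((List.flatMap (colR (e + 3)))^[(p - c)] [List.ofFn (fun i => (m.1 i : ℕ))]).count (List.ofFn (fun i => (v.1 i : ℕ))) : ℕ) : K)).rank =
    (Matrix.of fun (v : {v : Fin k → Fin (e + 2) // (∑ i, (v i : ℕ)) + (j + (p - c) * (e + 1)) = k * (e + 1)})
        (m : {m : Fin k → Fin (e + 2) // (∑ i, (m i : ℕ)) + ((j + (p - c) * (e + 1)) + c * (e + 1)) = k * (e + 1)}) =>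
      ((((List.flatMap (colR (e + 3)))^[c] [List.ofFn (fun i => (m.1 i : ℕ))]).count (List.ofFn (fun i => (v.1 i : ℕ))) : ℕ) : K₀)).rank := by
  rw [rank_mulDeltaPow_levels_eq_sum_wilson K p k e c (j + (p - c) * (e + 1)) (cast_factorial_ne_zero K p hp c hcp),
    rank_mulDeltaPow_levels_eq_sum_wilson K p k e (p - c) j (cast_factorial_ne_zero K p hp (p - c) (by omega)),
    rank_mulDeltaPow_levels_eq_sum_wilson K₀ 0 k e c (j + (p - c) * (e + 1)) (by exact_mod_cast Nat.factorial_ne_zero c),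
    ← Finset.sum_add_distrib]
  exact Finset.sum_congr rfl (fun μ _ => blockval_add_blockval_eq p k e c j μ hp hc hcp h1 h2)

/-- (EX′) the signed form: `rank_{K₀}(×q^c at J) − rank_K(×q^c at J) = rank_K(×q^{p−c} at j)` — anchor 304's DROP at level `J = j + (p−c)(e+1)`
IS the characteristic-`p` rank of `×q^{p−c}` at level `j` (hypotheses of (EX)). -/
theorem rank_charZero_sub_rank_charP_eq_rank_charP (K K₀ : Type*) [Field K] [Field K₀] (p : ℕ) [CharP K p] [CharZero K₀] (hp : p.Prime)
    (k e c j : ℕ) (hc : 0 < c) (hcp : c < p) (h1 : j + (p - c) * (e + 1) + c ≤ k)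
    (h2 : 2 * (j + (p - c) * (e + 1)) + (e + 1) * c ≤ (e + 1) * k) :
    (Matrix.of fun (v : {v : Fin k → Fin (e + 2) // (∑ i, (v i : ℕ)) + (j + (p - c) * (e + 1)) = k * (e + 1)})
        (m : {m : Fin k → Fin (e + 2) // (∑ i, (m i : ℕ)) + ((j + (p - c) * (e + 1)) + c * (e + 1)) = k * (e + 1)}) =>
      ((((List.flatMap (colR (e + 3)))^[c] [List.ofFn (fun i => (m.1 i : ℕ))]).count (List.ofFn (fun i => (v.1 i : ℕ))) : ℕ) : K₀)).rank -
    (Matrix.of fun (v : {v : Fin k → Fin (e + 2) // (∑ i, (v i : ℕ)) + (j + (p - c) * (e + 1)) = k * (e + 1)})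
        (m : {m : Fin k → Fin (e + 2) // (∑ i, (m i : ℕ)) + ((j + (p - c) * (e + 1)) + c * (e + 1)) = k * (e + 1)}) =>
      ((((List.flatMap (colR (e + 3)))^[c] [List.ofFn (fun i => (m.1 i : ℕ))]).count (List.ofFn (fun i => (v.1 i : ℕ))) : ℕ) : K)).rank =
    (Matrix.of fun (v : {v : Fin k → Fin (e + 2) // (∑ i, (v i : ℕ)) + j = k * (e + 1)})
        (m : {m : Fin k → Fin (e + 2) // (∑ i, (m i : ℕ)) + (j + (p - c) * (e + 1)) = k * (e + 1)}) =>
      ((((List.flatMap (colR (e + 3)))^[(p - c)] [List.ofFn (fun i => (m.1 i : ℕ))]).count (List.ofFn (fun i => (v.1 i : ℕ))) : ℕ) : K)).rank := by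
  have h := rank_charP_add_rank_charP_eq_rank_charZero K K₀ p hp k e c j hc hcp h1 h2
  omega

/-- **(EX-period) FROBENIUS PERIODICITY OF THE MODULAR RANK.** For `1 ≤ c < p` and the levels `j₀`, `j₁ = j₀ + c(e+1)`, `j₂ = j₁ + (p−c)(e+1)
= j₀ + p(e+1)` with (H1) `j₂ + c ≤ k`, (H2) `2j₂ + (e+1)c ≤ (e+1)k`:
`rank_K(×q^c at j₂) + rank_{K₀}(×q^{p−c} at j₁) = rank_{K₀}(×q^c at j₂) + rank_K(×q^c at j₀)` — (EX) at `(c, j₂ | p−c, j₁)` and at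
`(p−c, j₁ | c, j₀)`.  Iterated down the ladder `j₂, j₂ − (p−c)(e+1), j₂ − p(e+1), …` it writes the modular rank as an alternating sum of
characteristic-`0` ranks (THEOREM L, anchor 229): the census form of anchor 304's `C(m,T) − C(m,T+c−p) + C(m,T−p) − ⋯`. -/
theorem rank_charP_add_rank_charZero_eq (K K₀ : Type*) [Field K] [Field K₀] (p : ℕ) [CharP K p] [CharZero K₀] (hp : p.Prime)
    (k e c j : ℕ) (hc : 0 < c) (hcp : c < p) (h1 : j + c * (e + 1) + (p - c) * (e + 1) + c ≤ k)
    (h2 : 2 * (j + c * (e + 1) + (p - c) * (e + 1)) + (e + 1) * c ≤ (e + 1) * k) :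
    (Matrix.of fun (v : {v : Fin k → Fin (e + 2) // (∑ i, (v i : ℕ)) + (j + c * (e + 1) + (p - c) * (e + 1)) = k * (e + 1)})
        (m : {m : Fin k → Fin (e + 2) // (∑ i, (m i : ℕ)) + ((j + c * (e + 1) + (p - c) * (e + 1)) + c * (e + 1)) = k * (e + 1)}) =>
      ((((List.flatMap (colR (e + 3)))^[c] [List.ofFn (fun i => (m.1 i : ℕ))]).count (List.ofFn (fun i => (v.1 i : ℕ))) : ℕ) : K)).rank +
    (Matrix.of fun (v : {v : Fin k → Fin (e + 2) // (∑ i, (v i : ℕ)) + (j + c * (e + 1)) = k * (e + 1)})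
        (m : {m : Fin k → Fin (e + 2) // (∑ i, (m i : ℕ)) + ((j + c * (e + 1)) + (p - c) * (e + 1)) = k * (e + 1)}) =>
      ((((List.flatMap (colR (e + 3)))^[(p - c)] [List.ofFn (fun i => (m.1 i : ℕ))]).count (List.ofFn (fun i => (v.1 i : ℕ))) : ℕ) : K₀)).rank =
    (Matrix.of fun (v : {v : Fin k → Fin (e + 2) // (∑ i, (v i : ℕ)) + (j + c * (e + 1) + (p - c) * (e + 1)) = k * (e + 1)})
        (m : {m : Fin k → Fin (e + 2) // (∑ i, (m i : ℕ)) + ((j + c * (e + 1) + (p - c) * (e + 1)) + c * (e + 1)) = k * (e + 1)}) =>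
      ((((List.flatMap (colR (e + 3)))^[c] [List.ofFn (fun i => (m.1 i : ℕ))]).count (List.ofFn (fun i => (v.1 i : ℕ))) : ℕ) : K₀)).rank +
    (Matrix.of fun (v : {v : Fin k → Fin (e + 2) // (∑ i, (v i : ℕ)) + j = k * (e + 1)})
        (m : {m : Fin k → Fin (e + 2) // (∑ i, (m i : ℕ)) + (j + c * (e + 1)) = k * (e + 1)}) =>
      ((((List.flatMap (colR (e + 3)))^[c] [List.ofFn (fun i => (m.1 i : ℕ))]).count (List.ofFn (fun i => (v.1 i : ℕ))) : ℕ) : K)).rank := by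
  have hA := rank_charP_add_rank_charP_eq_rank_charZero K K₀ p hp k e c (j + c * (e + 1)) hc hcp h1 h2
  have hB := rank_charP_add_rank_charP_eq_rank_charZero K K₀ p hp k e (p - c) j (by omega) (by omega)
    (by rw [Nat.sub_sub_self hcp.le]; nlinarith [Nat.zero_le ((p - c) * (e + 1))])
    (by rw [Nat.sub_sub_self hcp.le]; nlinarith [Nat.zero_le ((p - c) * (e + 1))])
  rw [Nat.sub_sub_self hcp.le] at hB
  omega

end Summit.HodgeConjecture.HodgeConjecture.HodgeLocus.Census.UnitColumnRankDropExact
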